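import Literature.MathematicalPhysics.QuantumFieldTheory.Balaban1983to89.B16RLeafRecord13SepCoPR

/-!
# `Balaban1983to89.B14NodeKnitRecord13RCoPR` — YM-DAG node N11 ([Balaban1988Convergent] Thm 1 p. 262) with 𝐑 EXPLICIT AND PRINT-FAITHFUL AT NODE 00's RECORD 13 v1.6 `CoPR`
# (node00-def-T FILE 23 `Node00/Record13CoP.lean` + FILE 24T `Node00/Record13SepCoP.lean`, KEY-23∕KEY-24T): [III]'s Theorem of p. 245 (`B14.ThmP245PrintedI` ∕ `…SpacesI`) and
# p. 244 assumption (`B14.RAssumedP244`) READ AT THE v1.6 OBJECTS OF RECORD (`VOfRecord₁₃CoPR`, `SLaw₁₃CoPR`∕`TLaw₁₃CoPR`), Theorem 1 relative to 𝐑, the node with 𝐑 consumed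
# from its own antecedent, the (B)-face's first conjunct from [III]'s two sentences — the `CoPR` twin of this seat's `…B14NodeKnitRecord13R`

statement-level bookkeeping over published theorems with citation tags; kernel-checked compositions of tree theorems;
nothing here is a claim about the Yang–Mills mass gap.

v1.6 `CoPR` PORT (seat dag-n11-e g9; director-ym LINE №169 RULING H1 on node00-def-T LOCATED-8 = FINDING №8 «the residual 𝐓-weight slot `Stage12Params.Zt` is RUN-BLIND»,
LINE №174 PRESS WORD «pens port their OWN files by token map»): this module is the v1.5 storey `…B14NodeKnitRecord13RCoP` (p525369) under node00-def-T's token map T₆ of FILE 25∕26T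
(`Node00/Record13CoPR.lean` p529474, `Node00/Record13SepCoPR.lean`; `keymap-CoPR.tsv`): `θ : Stage13Params ↦ θ : Stage13RParams` (`extends Stage13Params`, ONE new field
`Zr : (p : B12.RunParams) → TkResidualW F N (FluctV N) p.K`), `θ.Zt p.K ↦ θ.Zr p`, `WtOfRecord₁₃P ↦ WtOfRecord₁₃R θ p := tkWeightsOfRecordP … (gOfRecord₁₃ θ.toStage13Params p) (θ.Zr p)`,
`XCoP ↦ XCoPR`, `Provisos₁₃Core ↦ Provisos₁₃CoPR`, `Provisos₁₃SepCoP ↦ Provisos₁₃SepCoPR`; the residual-free objects `densOfRecord₁₃ ∕ tdensOfRecord₁₃ ∕ EOfRecord₁₃ ∕ gOfRecord₁₃ ∕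
settingOfRecord₁₃ ∕ suppOfRecord₁₃SepCoP ∕ UbgOfRecord₁₃CoP` are read at `θ.toStage13Params` (the background is NOT re-issued, №176).  The live-line 𝐑-chain reads the 𝐓-weights
only as the argument `W` of `sect2Slot` ((G6′) `…B16RLeafRecord13LiveGenericW` is `W`-generic), so nothing below depends on `Zr`; the WITNESS faces are stated at EVERY
run-indexed extension `(⟨θ₀, Zr⟩ : Stage13RParams F N)` of a Stage-13 witness `θ₀` (`Zr` a free variable of the section) — node00-def-K0a's cured family
`Stage13RParams.ofCured θ₀ = ⟨θ₀, ZrOfRecord₁₃ F N θ₀⟩` (INTENT-18b) and def-T's run-blind embedding `ofRunBlind θ₀` are instances by `rfl`.  Below, «v1.5 ∕ CoP» in the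
inherited prose refers to the objects' origin; every declaration is stated at the v1.6 `CoPR` names.

Cell `pub-ymgap` (HUMAN RULING D-0062, Track A), seat `pub-ymgap-dag-n11-e` (R134 fan-out row N11∕s3 «`ThmP245Printed` :375 via `rOperation` from N13's `ROpLeaf`
(pairs with n13-c)»), generation 8.  [III] = [Balaban1988Convergent], [B16] = [Balaban1989LargeFieldII].  The v1.5 twin of this seat's g5 module `…B14NodeKnitRecord13R`
(p492984, keyed on v1.2 `VOfRecord₁₃`∕`SLaw₁₃`∕`TLaw₁₃`∕`datumOfRecord₁₃ θ (h : Provisos₁₃)`), re-keyed by node00-def-T's KEY-23 (`VOfRecord₁₃ ↦ VOfRecord₁₃CoPR`, `SLaw₁₃ ↦ SLaw₁₃CoPR`,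
`TLaw₁₃ ↦ TLaw₁₃CoPR`, `rOpLeaf_VOfRecord₁₃_iff ↦ rOpLeaf_VOfRecord₁₃CoPR_iff`, `toStage5₁₃ ↦ toStage5₁₃CoPR`, `coreOfRecord₁₃ ↦ coreOfRecord₁₃CoPR`, `towerOfRecord₁₃ ↦ towerOfRecord₁₃CoPR`,
`datumOfRecord₁₃ θ h ↦ datumOfRecord₁₃CoPR θ (h : Provisos₁₃CoPR)`, `WtOfRecord₁₃ ↦ WtOfRecord₁₃R`, `UbgOfRecord₁₃ ↦ UbgOfRecord₁₃CoP`,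
`thm1Printed_datumOfRecord₁₃_of_tLaw_rOpLeaf ↦ thm1Printed_datumOfRecord₁₃CoPR_of_tLaw_rOpLeaf`; `densOfRecord₁₃`∕`tdensOfRecord₁₃` UNCHANGED — background- and weight-free),
with the induction and the node taken BY NAME from this seat's `…B16RLeafRecord13LiveCoPR` (p523288: `sLaw₁₃CoPR_all_of_laws`, `densitiesDescribed_at_record₁₃CoPR_of_laws`,
`b14_main_at_record₁₃CoPR_of_rOpLeaf`, and — for §5's live-line corollaries — `rOpLeaf_VOfRecord₁₃CoPR_of_liveSel_of_rstep` and the CLOSED leaf at node00-def-K0a's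
witness of record `rOpLeaf_VOfRecord₁₃CoPR_theta13LiveOfRecord`).

WHY THIS FILE (what s3 adds next to s1∕s2 at v1.5).  The rev-20 K1⁵ text `StabilityBAtRecordR13SepCoP` binds a world to `datumOfRecord₁₃SepCoPR θ h`
(`= datumOfRecord₁₃CoPR θ h.toCore`, `rfl`); the ⁵ knits (dag-n24-c) state N11 there in SLOT currency with the (𝐑) antecedent read through a law-transport pin.  Here
nothing is unfolded inside a statement: 𝐑 stays the Prop print assumes — `B14.RAssumedP244` at the v1.5 carriers of record ∕ `ROpLeaf (VOfRecord₁₃CoPR …)` — and the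
Theorem of p. 245 keeps [III]'s own slot names `B14.ThmP245PrintedI` ∕ `B14.ThmP245SpacesI` (sequence and space readings, for ANY transformation family `T` agreeing with
the tower on the trajectory of record): §1 the leaf at a v1.5-bound run IS `ROpLeaf (VOfRecord₁₃CoPR θ P)` IS `RAssumedP244` at the carriers of record (`Iff.rfl` ×2) and is
YIELDED by N13's node statement (`rOpLeaf₁₃CoPR_of_b16_main`); §2 the four dictionaries «[III]'s sentence at the v1.5 objects of record ↔ law form»; §3 THEOREM 1 relative
to 𝐑 with NO start slot (`sLaw₁₃CoPR_all_of_rAssumedP244`; start = `Node00.sLaw₁₃CoPR_zero`), what it SAYS at print's ζ-weights `WtOfRecord₁₃R` and print's minimiser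
background `UbgOfRecord₁₃CoP` (`hasSect2FormAEZ_all_of_rAssumedP244_coP`), and `densitiesDescribed` at a bound world from the junction Prop; §4 the node side: the two A4
locators `sLaw₁₃CoPR_all_of_b14_main_of_rOpLeaf` (what N11 SAYS given its antecedents, 𝐑 as print assumes it) and `sLaw₁₃CoPR_all_of_b16_main_of_slots` (Theorem 1 at a
v1.5-bound run from N13's statement + N11's one slot, the junction BY NAME), and `b14_main_at_record₁₃CoPR_of_b16_main` (the node from N13's statement + (S1ᵀ)); §5 the
(B)-face's first conjunct `B16.Thm1Printed (datumOfRecord₁₃CoPR θ h).C` FROM [III]'s TWO SENTENCES IN [III]'s CURRENCY (`thm1Printed_datumOfRecord₁₃CoPR_of_laws_rAssumedP244`,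
`thm1Printed_datumOfRecord₁₃CoPR_of_thmP245I_rAssumedP244`) and — the director's row literally, ON THE LIVE-SELECTOR LINE where N13's leaf is a theorem of `…LiveCoP` —
★ `thm1Printed_datumOfRecord₁₃CoPR_of_thmP245I_of_liveSel` (from `Provisos₁₃CoPR`'s row `rstep`) and its K1⁵-keyed form ★ `thm1Printed_datumOfRecord₁₃SepCoPR_of_thmP245I_of_liveSel`
(`h : Provisos₁₃SepCoPR`): «`ThmP245Printed` via `rOperation` from N13's `ROpLeaf`» with the `ROpLeaf` SUPPLIED; ★★ `thm1Printed_datumOfRecord₁₃CoPR_theta13LiveOfRecord_of_thmP245I`: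
the same AT THE WITNESS OF RECORD `theta13LiveOfRecord F N` from [III]'s Theorem of p. 245 in its own name — the leaf CLOSED, `hrec : Provisos₁₃CoPR` only the datum's
key.  (The `IsRecordOfRecord₁₃CCoPR`-keyed (D, w)-face is `…B16RLeafRecord13LiveCoPR.densitiesDescribed_of_isRecordOfRecord₁₃CCoPR_of_rOperation`, not restated.)

HONEST FRAMING.  Dictionary ∕ composition bookkeeping; 0 `def`; the Theorem of p. 245 (Sects. 1–3 of [III]) and, off the live line, the p. 244 assumption ([B16]
Thm 1) are DISPLAYED hypotheses; the `T`-family binder ranges over the cell's `RTOpI` carrier (dictionary-level only; the load-bearing content is the law reading);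
on the live line 𝐑 of record integrates out only terms of zero fibre mass ([B16] Thm 1's 𝐑-construction NOT exercised); whether (S1ᵀ)'s first instance holds at v1.5 is
seat dag-n11-d's lane; nothing of Bałaban's analysis is asserted; N11 NOT discharged; K1⁵ (stmt-QuantumFields-20294) NOT closed; counts unmoved; general `N`; one finite
`𝕋⁴_{L^K}` programme at fixed `ε = L^{−K}` — NOT a continuum ∕ OS ∕ mass-gap ∕ Clay statement.
-/

noncomputable section

open MeasureTheory
open scoped BigOperators Matrix.Norms.L2Operator

namespace Literature.MathematicalPhysics.QuantumFieldTheory.Balaban1983to89.B14NodeKnitRecord13RCoPR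

open T4Continuum T4DatumAssembly Node00 B14.Eq218Concrete DagBinding
open B16RLeafRecord13Live B16RLeafRecord13AtLive B16RLeafRecord13LiveRstep B16RLeafRecord13LiveGenericW B16RLeafRecord13LiveCoPR B16RLeafRecord13SepCoPR
open B14NodeKnitTowerDatum (densitiesDescribed_iff_core)

variable (F : T4Family) (N : ℕ) [NeZero N]

/-! ## §1. The 𝐑-antecedent at Stage 13, PRINT-FAITHFUL: the leaf at the carriers of record, by name, and as [III]'s p. 244 sentence -/

section Leaf

variable (θ : Stage13RParams F N) (w : WorldP) (P : B12.RunParams)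

/-- **THE 𝐑-ANTECEDENT OF N11 AT A STAGE-13-BOUND RUN IS THE LEAF AT THE CARRIERS OF RECORD** (the junction Prop with N13, BY NAME): at `w.up P = upOfRecord₅C F N
(θ.toStage5₁₃CoPR F N) P`, `(leavesP w P).rOperation ↔ ROpLeaf (VOfRecord₁₃CoPR F N θ P)` (`Iff.rfl` behind the binding equation; nothing unfolded — the law-transport
unfolding is dag-n24-c's `rOperation_iff_laws₁₃` (at v1.2)). [cite: Balaban1988Convergent, p.244 (bookkeeping: the leaf named)] -/
theorem rOperation_iff_rOpLeaf₁₃CoPR (hup : w.up P = upOfRecord₅C F N (θ.toStage5₁₃CoPR F N) P) :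
    (leavesP w P).rOperation ↔ ROpLeaf (VOfRecord₁₃CoPR F N θ P) := by
  show (w.up P).rOperation ↔ _
  rw [hup]
  exact Iff.rfl

/-- **THE LEAF AT THE STAGE-13 CARRIERS OF RECORD IS [III]'s TYPED p. 244 SENTENCE** (`B14.RAssumedP244`, verbatim there: *«we will only assume that it has some
properties incorporated in the inductive description of the effective actions»*) for the density operation, target space and corresponding space OF RECORD along the
run `P` (`Iff.rfl`: `DagBinding.ROpLeaf` is this by definition). [cite: Balaban1988Convergent, p.244] -/
theorem rOpLeaf₁₃CoPR_iff_rAssumedP244 :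
    ROpLeaf (VOfRecord₁₃CoPR F N θ P) ↔
      B14.RAssumedP244 (VOfRecord₁₃CoPR F N θ P).R (VOfRecord₁₃CoPR F N θ P).Scorr (VOfRecord₁₃CoPR F N θ P).S P.K :=
  Iff.rfl

/-- **THE PRODUCER'S SIDE OF THE JUNCTION, Stage 13** (node N13 = [Balaban1989LargeFieldII] Thm 1, `Dag.B16_main`, whose conclusion's first conjunct is
`ℓ.rOperation`): at a Stage-13-bound run, N13's node statement with its in-edge leaves and the small-field implication YIELDS the leaf at the carriers of record
`ROpLeaf (VOfRecord₁₃CoPR F N θ P)` — the Prop the dag-n13 lineage is asked to inhabit at Stage 13, BY NAME. [cite: Balaban1989LargeFieldII, Thm 1 p.355 (bookkeeping); Balaban1988Convergent, p.244] -/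
theorem rOpLeaf₁₃CoPR_of_b16_main (hup : w.up P = upOfRecord₅C F N (θ.toStage5₁₃CoPR F N) P) (hN : Dag.B16_main (leavesP w P))
    (h5 : (leavesP w P).b5) (h6 : (leavesP w P).b6) (h7 : (leavesP w P).b7) (h9 : (leavesP w P).b9) (h10 : (leavesP w P).b10)
    (h11 : (leavesP w P).b11) (h13 : (leavesP w P).b13) (hrb : (leavesP w P).rBasicStep)
    (hsf : (leavesP w P).smallCouplings → (leavesP w P).smallFieldInductive) :
    ROpLeaf (VOfRecord₁₃CoPR F N θ P) :=
  (rOperation_iff_rOpLeaf₁₃CoPR F N θ w P hup).1 (hN h5 h6 h7 h9 h10 h11 h13 hrb hsf).1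

end Leaf

/-! ## §2. [III]'s sentences READ AT THE STAGE-13 OBJECTS OF RECORD: the Theorem of p. 245 (sequence and space readings), the p. 244 assumption -/

section Sentences

variable (θ : Stage13RParams F N) (w : WorldP) (P : B12.RunParams)

/-- **THE THEOREM OF p. 245, SEQUENCE READING, ALONG THE TRAJECTORY OF RECORD, Stage 13** ([Balaban1988Convergent] p. 245, verbatim: *«Theorem. If ρ_k satisfies the
assumptions described in detail in Sect. 2, then Tρ_k satisfies also the corresponding assumptions.»*): with `ρ_k := densOfRecord₁₃ θ P k` in the target space of
record and `𝐓ρ_k := tdensOfRecord₁₃ θ P k` tested in the corresponding space, the sentence IS `∀ k < K, SLaw₁₃CoPR θ P k → TLaw₁₃CoPR θ P k`.  Bookkeeping.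
[cite: Balaban1988Convergent, Theorem p.245; (3.25) p.270] -/
theorem thmP245_at_record₁₃CoPR_iff_laws :
    (∀ k, k < P.K → (VOfRecord₁₃CoPR F N θ P).S k (densOfRecord₁₃ F N θ.toStage13Params P k) →
        (VOfRecord₁₃CoPR F N θ P).Scorr (k + 1) (tdensOfRecord₁₃ F N θ.toStage13Params P k)) ↔
      ∀ k, k < P.K → SLaw₁₃CoPR F N θ P k → TLaw₁₃CoPR F N θ P k := by
  refine ⟨fun h k hk hS => ?_, fun h k hk hS => ?_⟩
  · have hT : tdensOfRecord₁₃ F N θ.toStage13Params P k = tdensOfRecord₁₃ F N θ.toStage13Params P k ∧ TLaw₁₃CoPR F N θ P k := h k hk ⟨rfl, hS⟩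
    exact hT.2
  · exact ⟨rfl, h k hk hS.2⟩

/-- **[III]'s OWN SLOT NAME AT THE STAGE-13 RECORD**: for ANY family `T` of renormalization transformations on the run's lattices (the cell's carrier `RTOpI` along
the averaging of record) that AGREES WITH THE TOWER ON THE TRAJECTORY (`(T k).T ρ_k = 𝐓ρ_k` of record, `k < K`), the typed Theorem of p. 245
`B14.ThmP245PrintedI T ρ S Scorr K` at `ρ := densOfRecord₁₃ θ P`, the Stage-13 spaces of record and `K := P.K` IS `∀ k < K, SLaw₁₃CoPR θ P k → TLaw₁₃CoPR θ P k`.  (The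
`RTOp`-form `B14.ThmP245Printed` is the same Prop along `RTOp.toRTOpI`, `B14.thmP245PrintedI_toRTOpI_iff`.)  Dictionary lemma; the closers below are `T`-free.
[cite: Balaban1988Convergent, Theorem p.245] -/
theorem thmP245PrintedI_at_record₁₃CoPR_iff_laws (T : (k : ℕ) → RTOpI (F.P P.K) k (SU N) (avOfRecord F N P.K k))
    (hT : ∀ k, k < P.K → (T k).T (densOfRecord₁₃ F N θ.toStage13Params P k) = tdensOfRecord₁₃ F N θ.toStage13Params P k) :
    B14.ThmP245PrintedI T (densOfRecord₁₃ F N θ.toStage13Params P) (VOfRecord₁₃CoPR F N θ P).S (VOfRecord₁₃CoPR F N θ P).Scorr P.K ↔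
      ∀ k, k < P.K → SLaw₁₃CoPR F N θ P k → TLaw₁₃CoPR F N θ P k := by
  refine ⟨fun h k hk hS => ?_, fun h k hk hS => ?_⟩
  · have hT' : (T k).T (densOfRecord₁₃ F N θ.toStage13Params P k) = tdensOfRecord₁₃ F N θ.toStage13Params P k ∧ TLaw₁₃CoPR F N θ P k := h k hk ⟨rfl, hS⟩
    exact hT'.2
  · exact ⟨hT k hk, h k hk hS.2⟩

/-- **THE SPACE READING OF THE THEOREM OF p. 245 AT THE STAGE-13 RECORD COINCIDES WITH THE SEQUENCE READING** ([Balaban1988Convergent] p. 262, second remark: *«…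
the operation 𝐑T transforms the space with the index k into the space with the index k+1. This generalization does not seem to be useful, or interesting now.»* —
typed `B14.ThmP245SpacesI`): at the carriers of record the index-`k` space IS `{ρ : ρ = ρ_k ∧ SLaw₁₃CoPR θ P k}`, so for any agreeing `T`-family the space reading IS
`∀ k < K, SLaw₁₃CoPR θ P k → TLaw₁₃CoPR θ P k`.  Dictionary lemma. [cite: Balaban1988Convergent, Theorem p.245 with remark p.262] -/
theorem thmP245SpacesI_at_record₁₃CoPR_iff_laws (T : (k : ℕ) → RTOpI (F.P P.K) k (SU N) (avOfRecord F N P.K k))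
    (hT : ∀ k, k < P.K → (T k).T (densOfRecord₁₃ F N θ.toStage13Params P k) = tdensOfRecord₁₃ F N θ.toStage13Params P k) :
    B14.ThmP245SpacesI T (VOfRecord₁₃CoPR F N θ P).S (VOfRecord₁₃CoPR F N θ P).Scorr P.K ↔
      ∀ k, k < P.K → SLaw₁₃CoPR F N θ P k → TLaw₁₃CoPR F N θ P k := by
  refine ⟨fun h => ?_, fun h k hk ρ hρ => ?_⟩
  · exact (thmP245PrintedI_at_record₁₃CoPR_iff_laws F N θ P T hT).1 (B14.thmP245PrintedI_of_spacesI h (densOfRecord₁₃ F N θ.toStage13Params P))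
  · obtain ⟨rfl, hS⟩ := hρ
    exact ⟨hT k hk, h k hk hS⟩

/-- **THE p. 244 ASSUMPTION AT THE STAGE-13 CARRIERS OF RECORD IS «𝐓-IMAGE FORM ⇒ §2 FORM ONE LEVEL UP»**: `B14.RAssumedP244` at `VOfRecord₁₃CoPR θ P` ↔
`∀ k < K, TLaw₁₃CoPR θ P k → SLaw₁₃CoPR θ P (k+1)` — node00-def-T's `rOpLeaf_VOfRecord₁₃CoPR_iff`, quoted through §1.
[cite: Balaban1988Convergent, p.244 and Thm 2 p.263 (bookkeeping: the leaf unfolded, by name)] -/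
theorem rAssumedP244_at_record₁₃CoPR_iff_laws :
    B14.RAssumedP244 (VOfRecord₁₃CoPR F N θ P).R (VOfRecord₁₃CoPR F N θ P).Scorr (VOfRecord₁₃CoPR F N θ P).S P.K ↔
      ∀ k, k < P.K → TLaw₁₃CoPR F N θ P k → SLaw₁₃CoPR F N θ P (k + 1) :=
  (rOpLeaf₁₃CoPR_iff_rAssumedP244 F N θ P).symm.trans (rOpLeaf_VOfRecord₁₃CoPR_iff F N θ P)

end Sentences

/-! ## §3. THEOREM 1 [III] AT THE STAGE-13 OBJECTS OF RECORD, RELATIVE TO 𝐑 — no world, no binding, NO START SLOT: `θ` and the run `P` only -/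

section Thm1Relative

variable (θ : Stage13RParams F N) (P : B12.RunParams)

/-- **THEOREM 1 [III] AT THE OBJECTS OF RECORD, RELATIVE TO 𝐑, THE START A THEOREM** ([Balaban1988Convergent] Thm 1 p. 262; printed proof structure = START +
THE THEOREM OF p. 245 + THE ASSUMED 𝐑 along (0.2)), re-run at the Stage-13 laws of record (base `sLaw₁₃CoPR_zero`; the induction is this seat's `sLaw₁₃CoPR_all_of_laws`).
Hypotheses, both DISPLAYED and PRINTED: `hR` — `B14.RAssumedP244` at the 𝐑-carriers of record (= `ROpLeaf (VOfRecord₁₃CoPR …)`, N13's product); `hT` — the Theorem of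
p. 245 at the objects of record.  Conclusion: EVERY `ρ_k` of record, `k ≤ K`, has the repaired §2 [III] form of record.  Count-neutral.
[cite: Balaban1988Convergent, Thm 1 p.262; Theorem p.245; p.244] -/
theorem sLaw₁₃CoPR_all_of_rAssumedP244
    (hR : B14.RAssumedP244 (VOfRecord₁₃CoPR F N θ P).R (VOfRecord₁₃CoPR F N θ P).Scorr (VOfRecord₁₃CoPR F N θ P).S P.K)
    (hT : ∀ k, k < P.K → SLaw₁₃CoPR F N θ P k → TLaw₁₃CoPR F N θ P k) :
    ∀ k, k ≤ P.K → SLaw₁₃CoPR F N θ P k :=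
  sLaw₁₃CoPR_all_of_laws F N θ P ((rAssumedP244_at_record₁₃CoPR_iff_laws F N θ P).1 hR) hT

/-- **What Theorem 1 SAYS at Stage 13, relative to 𝐑**: for every `k ≤ K` the post-𝐑 slot family of `ρ_k` of record HAS THE REPAIRED §2 [III] FORM (`HasSect2FormAEZ`)
AT THE 𝐓-WEIGHTS OF RECORD OF THE RUN `WtOfRecord₁₃R θ P` and the repaired backgrounds `UbgOfRecord₁₃CoP` — `Node00.sLaw₁₃CoPR_iff`.
[cite: Balaban1988Convergent, Thm 1 p.262, (2.18) p.257, (2.23)–(2.42) pp.258–261] -/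
theorem hasSect2FormAEZ_all_of_rAssumedP244_coP
    (hR : B14.RAssumedP244 (VOfRecord₁₃CoPR F N θ P).R (VOfRecord₁₃CoPR F N θ P).Scorr (VOfRecord₁₃CoPR F N θ P).S P.K)
    (hT : ∀ k, k < P.K → SLaw₁₃CoPR F N θ P k → TLaw₁₃CoPR F N θ P k) (k : ℕ) (hk : k ≤ P.K) :
    HasSect2FormAEZ F N (FluctV N) P.K (settingOfRecord₁₃ F N θ.toStage13Params P) (θ.Rz P.K) (WtOfRecord₁₃R F N θ P) k (UbgOfRecord₁₃CoP F N θ.toStage13Params P k)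
      (slotsOfRecord F N θ.ν θ.τ9 (EOfRecord₁₃ F N θ.toStage13Params) (wOfRecord₉ F N θ.toStage9Params) θ.ppSel P (gOfRecord₁₃ F N θ.toStage13Params P) k) :=
  (sLaw₁₃CoPR_iff F N θ P k).1 (sLaw₁₃CoPR_all_of_rAssumedP244 F N θ P hR hT k hk)

variable (w : WorldP) (h : θ.Provisos₁₃CoPR F N)

/-- **Theorem 1's conclusion `densitiesDescribed` AT A STAGE-13 WORLD, RELATIVE TO 𝐑** — with 𝐑 displayed as THE LEAF AT THE CARRIERS OF RECORD `ROpLeaf (VOfRecord₁₃CoPR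
F N θ.toStage13Params P)` (the Prop node N13 produces): at `w.C = (datumOfRecord₁₃CoPR F N θ h).C`, the leaf + the Theorem of p. 245 at the objects of record give
`(leavesP w P).densitiesDescribed` — no start hypothesis. [cite: Balaban1988Convergent, Thm 1 p.262; Theorem p.245; p.244] -/
theorem densitiesDescribed_at_record₁₃CoPR_of_rOpLeaf (hC : w.C = (datumOfRecord₁₃CoPR F N θ h).C) (hR : ROpLeaf (VOfRecord₁₃CoPR F N θ P))
    (hT : ∀ k, k < P.K → SLaw₁₃CoPR F N θ P k → TLaw₁₃CoPR F N θ P k) :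
    (leavesP w P).densitiesDescribed :=
  densitiesDescribed_at_record₁₃CoPR_of_laws F N θ P w h hC ((rOpLeaf_VOfRecord₁₃CoPR_iff F N θ P).1 hR) hT

end Thm1Relative

/-! ## §4. THE NODE at a Stage-13 world, A4 locators: what N11 SAYS given its antecedents (𝐑 as print assumes it), and Theorem 1 from the two nodes' products -/

section Node

variable (θ : Stage13RParams F N) (h : θ.Provisos₁₃CoPR F N) (w : WorldP) (P : B12.RunParams)

/-- **What N11 SAYS at Stage 13, the 𝐑-antecedent AS PRINT ASSUMES IT** (A4 locator, vacuity audit in kernel form): N11 at a world bound to the datum of record, GIVEN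
its in-edge leaves, the small-field implication, the located flow step, the interval hypothesis, the reading `hV` AND THE LEAF AT THE CARRIERS OF RECORD `ROpLeaf
(VOfRecord₁₃CoPR F N θ P)` — node N13's product, by name — YIELDS the repaired §2 [III] form of every `ρ_k` of record, `∀ k ≤ K, SLaw₁₃CoPR θ P k`.
[cite: Balaban1988Convergent, Thm 1 p.262 (bookkeeping); p.244] -/
theorem sLaw₁₃CoPR_all_of_b14_main_of_rOpLeaf (hC : w.C = (datumOfRecord₁₃CoPR F N θ h).C) (hV : ROpLeaf (VOfRecord₁₃CoPR F N θ P) → (leavesP w P).rOperation)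
    (hN : Dag.B14_main (leavesP w P))
    (h7 : (leavesP w P).b7) (h8 : (leavesP w P).b8) (h9 : (leavesP w P).b9) (h10 : (leavesP w P).b10) (h11 : (leavesP w P).b11)
    (hsf : (leavesP w P).smallCouplings → (leavesP w P).smallFieldInductive)
    (hfc : (leavesP w P).smallCouplings → (leavesP w P).flowControl)
    (hR : ROpLeaf (VOfRecord₁₃CoPR F N θ P)) (hsc : (leavesP w P).smallCouplings) :
    ∀ k, k ≤ P.K → SLaw₁₃CoPR F N θ P k :=
  (densitiesDescribed_iff_core F N (coreOfRecord₁₃CoPR F N θ) (towerOfRecord₁₃CoPR F N θ h) w P hC).1 (hN h7 h8 h9 h10 h11 hsf hfc (hV hR) hsc)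

/-- **THEOREM 1 [III] AT A STAGE-13-BOUND RUN FROM THE TWO NODES' PRINTED PRODUCTS, the junction BY NAME** (how `Dag.uv_stability_of_series` hands N13's product to
N11, read at the objects of record): at a run bound by `w.up P = upOfRecord₅C F N (θ.toStage5₁₃CoPR F N) P`, GIVEN node N13's statement `Dag.B16_main (leavesP w P)` with
ITS in-edge leaves and `rBasicStep` — which YIELDS the leaf (§1) —, N11's ONE slot (S1ᵀ) at the objects of record and N11's remaining antecedents: under the interval
hypothesis EVERY `ρ_k` of record, `k ≤ K`, has the repaired §2 [III] form of record.  Pure composition; both nodes' analytic contents stay displayed.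
[cite: Balaban1988Convergent, Thm 1 p.262; Theorem p.245; p.244; Balaban1989LargeFieldII, Thm 1 p.355] -/
theorem sLaw₁₃CoPR_all_of_b16_main_of_slots (hup : w.up P = upOfRecord₅C F N (θ.toStage5₁₃CoPR F N) P)
    (hN13 : Dag.B16_main (leavesP w P))
    (h5 : (leavesP w P).b5) (h6 : (leavesP w P).b6) (h7 : (leavesP w P).b7) (h8 : (leavesP w P).b8) (h9 : (leavesP w P).b9)
    (h10 : (leavesP w P).b10) (h11 : (leavesP w P).b11) (h13 : (leavesP w P).b13) (hrb : (leavesP w P).rBasicStep)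
    (hsf : (leavesP w P).smallCouplings → (leavesP w P).smallFieldInductive)
    (hfc : (leavesP w P).smallCouplings → (leavesP w P).flowControl)
    (hT : (leavesP w P).b7 → (leavesP w P).b8 → (leavesP w P).b9 → (leavesP w P).b10 → (leavesP w P).b11 →
      (leavesP w P).smallCouplings → (leavesP w P).smallFieldInductive → (leavesP w P).flowControl →
        ∀ k, k < P.K → SLaw₁₃CoPR F N θ P k → TLaw₁₃CoPR F N θ P k)
    (hsc : (leavesP w P).smallCouplings) : ∀ k, k ≤ P.K → SLaw₁₃CoPR F N θ P k :=
  have hR : ROpLeaf (VOfRecord₁₃CoPR F N θ P) := rOpLeaf₁₃CoPR_of_b16_main F N θ w P hup hN13 h5 h6 h7 h9 h10 h11 h13 hrb hsf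
  sLaw₁₃CoPR_all_of_rAssumedP244 F N θ P ((rOpLeaf₁₃CoPR_iff_rAssumedP244 F N θ P).1 hR) (hT h7 h8 h9 h10 h11 hsc (hsf hsc) (hfc hsc))

/-- **N11 ∧ N13's 𝐑-product AT A STAGE-13-BOUND WORLD, the junction by name**: from N13's node statement (+ its in-edges) and N11's (S1ᵀ), `Dag.B14_main (leavesP w P)`
— this seat's `b14_main_at_record₁₃CoPR_of_rOpLeaf` with the leaf READ from N13's statement (§1). [cite: Balaban1988Convergent, Thm 1 p.262; Theorem p.245; p.244; Balaban1989LargeFieldII, Thm 1 p.355] -/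
theorem b14_main_at_record₁₃CoPR_of_b16_main (hC : w.C = (datumOfRecord₁₃CoPR F N θ h).C) (hup : w.up P = upOfRecord₅C F N (θ.toStage5₁₃CoPR F N) P)
    (hN13 : Dag.B16_main (leavesP w P))
    (h5 : (leavesP w P).b5) (h6 : (leavesP w P).b6) (h13 : (leavesP w P).b13) (hrb : (leavesP w P).rBasicStep)
    (hT : (leavesP w P).b7 → (leavesP w P).b8 → (leavesP w P).b9 → (leavesP w P).b10 → (leavesP w P).b11 →
      (leavesP w P).smallCouplings → (leavesP w P).smallFieldInductive → (leavesP w P).flowControl →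
        ∀ k, k < P.K → SLaw₁₃CoPR F N θ P k → TLaw₁₃CoPR F N θ P k) :
    Dag.B14_main (leavesP w P) := by
  intro h7 h8 h9 h10 h11 hsf hfc _ hsc
  exact (densitiesDescribed_iff_core F N (coreOfRecord₁₃CoPR F N θ) (towerOfRecord₁₃CoPR F N θ h) w P hC).2
    (sLaw₁₃CoPR_all_of_b16_main_of_slots F N θ w P hup hN13 h5 h6 h7 h8 h9 h10 h11 h13 hrb hsf hfc hT hsc)

end Node

/-! ## §5. [V]∕[III] THEOREM 1 AS THE TREE STATES IT (`B16.Thm1Printed` at the Stage-13 datum of record) FROM [III]'s TWO SENTENCES IN [III]'s CURRENCY -/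

section Thm1Printed

variable (Zr : (q : B12.RunParams) → TkResidualW F N (FluctV N) q.K) (θ : Stage13RParams F N) (h : θ.Provisos₁₃CoPR F N)

/-- **`B16.Thm1Printed (datumOfRecord₁₃CoPR F N θ h).C` FROM THE THEOREM OF p. 245 AND THE p. 244 ASSUMPTION AT THE OBJECTS OF RECORD, law currency, `T`-free** (the
route's (B)-face first conjunct): along every run whose flow stays in a window `]0, γ]` (`0 < γ`), `hT` (N11's product) and `B14.RAssumedP244` at the Stage-13 carriers
of record (`hR`, N13's product AS [III] ASSUMES IT) give Theorem 1 at the datum — node00-def-T's `thm1Printed_datumOfRecord₁₃CoPR_of_tLaw_rOpLeaf` read through §1.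
[cite: Balaban1988Convergent, Thm 1 p.262; Theorem p.245; p.244; Balaban1989LargeFieldII, Thm 1 p.355 + p.391] -/
theorem thm1Printed_datumOfRecord₁₃CoPR_of_laws_rAssumedP244 {γ : ℝ} (hγ : 0 < γ)
    (hT : ∀ P : B12.RunParams, ((datumOfRecord₁₃CoPR F N θ h).C P).flow.InInterval γ P.K →
      ∀ k, k < P.K → SLaw₁₃CoPR F N θ P k → TLaw₁₃CoPR F N θ P k)
    (hR : ∀ P : B12.RunParams, ((datumOfRecord₁₃CoPR F N θ h).C P).flow.InInterval γ P.K →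
      B14.RAssumedP244 (VOfRecord₁₃CoPR F N θ P).R (VOfRecord₁₃CoPR F N θ P).Scorr (VOfRecord₁₃CoPR F N θ P).S P.K) :
    B16.Thm1Printed (datumOfRecord₁₃CoPR F N θ h).C :=
  thm1Printed_datumOfRecord₁₃CoPR_of_tLaw_rOpLeaf F N θ h hγ hT (fun P hP => (rOpLeaf₁₃CoPR_iff_rAssumedP244 F N θ P).2 (hR P hP))

/-- **`B16.Thm1Printed` AT THE STAGE-13 DATUM FROM [III]'s TWO SENTENCES IN [III]'s OWN NAMES** — `B14.ThmP245PrintedI` (the Theorem of p. 245, sequence reading, for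
any `T`-family agreeing with the tower on the trajectory of each windowed run) and `B14.RAssumedP244` (p. 244) at the Stage-13 carriers of record: the director's row
«`ThmP245Printed` via `rOperation` from N13's `ROpLeaf`» composed to the (B)-face's first conjunct, by name. [cite: Balaban1988Convergent, Thm 1 p.262; Theorem p.245; p.244; Balaban1989LargeFieldII, Thm 1 p.355] -/
theorem thm1Printed_datumOfRecord₁₃CoPR_of_thmP245I_rAssumedP244 {γ : ℝ} (hγ : 0 < γ)
    (T : (P : B12.RunParams) → (k : ℕ) → RTOpI (F.P P.K) k (SU N) (avOfRecord F N P.K k))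
    (hTT : ∀ (P : B12.RunParams) (k : ℕ), k < P.K → (T P k).T (densOfRecord₁₃ F N θ.toStage13Params P k) = tdensOfRecord₁₃ F N θ.toStage13Params P k)
    (hT : ∀ P : B12.RunParams, ((datumOfRecord₁₃CoPR F N θ h).C P).flow.InInterval γ P.K →
      B14.ThmP245PrintedI (T P) (densOfRecord₁₃ F N θ.toStage13Params P) (VOfRecord₁₃CoPR F N θ P).S (VOfRecord₁₃CoPR F N θ P).Scorr P.K)
    (hR : ∀ P : B12.RunParams, ((datumOfRecord₁₃CoPR F N θ h).C P).flow.InInterval γ P.K →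
      B14.RAssumedP244 (VOfRecord₁₃CoPR F N θ P).R (VOfRecord₁₃CoPR F N θ P).Scorr (VOfRecord₁₃CoPR F N θ P).S P.K) :
    B16.Thm1Printed (datumOfRecord₁₃CoPR F N θ h).C :=
  thm1Printed_datumOfRecord₁₃CoPR_of_laws_rAssumedP244 F N θ h hγ
    (fun P hP => (thmP245PrintedI_at_record₁₃CoPR_iff_laws F N θ P (T P) (hTT P)).1 (hT P hP)) hR

/-- **★ THE DIRECTOR's ROW LITERALLY, ON THE LIVE-SELECTOR LINE: `B16.Thm1Printed` AT THE STAGE-13 DATUM FROM [III]'s THEOREM OF p. 245 IN [III]'s OWN NAME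
(`B14.ThmP245PrintedI`) «via `rOperation` from N13's `ROpLeaf`» WITH THE `ROpLeaf` SUPPLIED** — at a `θ` carrying node00-def-T's live-selector clause `hsel` the leaf
is this seat's theorem `…B16RLeafRecord13LiveCoPR.rOpLeaf_VOfRecord₁₃CoPR_of_liveSel_of_rstep` (from `Provisos₁₃CoPR`'s row `rstep`, admissibility and the displayed
term-constant signs), so the (B)-face's first conjunct rests on the Theorem of p. 245 ALONE. [cite: Balaban1988Convergent, Theorem p.245, Thm 1 p.262, p.244; Balaban1989LargeFieldII, Thm 1 p.355; Balaban1989LargeFieldI, (0.3) p.176, p.177 (i)–(ii)] -/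
theorem thm1Printed_datumOfRecord₁₃CoPR_of_thmP245I_of_liveSel (hθ : θ.Admissible F N) (hκ : 0 ≤ θ.s2.lf.κ) (hE₀ : 0 ≤ θ.s2.lf.E₀) (hB₀ : 0 ≤ θ.s2.lf.B₀)
    (hsel : θ.ppSel = ppSelLiveOfRecord F N θ.ν θ.τ9 (EOfRecord₁₃ F N θ.toStage13Params) (wOfRecord₉ F N θ.toStage9Params)) {γ : ℝ} (hγ : 0 < γ)
    (T : (P : B12.RunParams) → (k : ℕ) → RTOpI (F.P P.K) k (SU N) (avOfRecord F N P.K k))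
    (hTT : ∀ (P : B12.RunParams) (k : ℕ), k < P.K → (T P k).T (densOfRecord₁₃ F N θ.toStage13Params P k) = tdensOfRecord₁₃ F N θ.toStage13Params P k)
    (hT : ∀ P : B12.RunParams, ((datumOfRecord₁₃CoPR F N θ h).C P).flow.InInterval γ P.K →
      B14.ThmP245PrintedI (T P) (densOfRecord₁₃ F N θ.toStage13Params P) (VOfRecord₁₃CoPR F N θ P).S (VOfRecord₁₃CoPR F N θ P).Scorr P.K) :
    B16.Thm1Printed (datumOfRecord₁₃CoPR F N θ h).C :=
  thm1Printed_datumOfRecord₁₃CoPR_of_thmP245I_rAssumedP244 F N θ h hγ T hTT hT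
    (fun P _ => (rOpLeaf₁₃CoPR_iff_rAssumedP244 F N θ P).1
      (rOpLeaf_VOfRecord₁₃CoPR_of_liveSel_of_rstep F N θ P (fun p k _ hk => h.rstep p k hk) hθ hκ hE₀ hB₀ hsel))

/-- **★★ THE ROW AT THE K0‴ WITNESS OF RECORD: `B16.Thm1Printed (datumOfRecord₁₃CoPR F N θ₁₃ h).C`, `θ₁₃ = theta13LiveOfRecord F N`, FROM [III]'s
THEOREM OF p. 245 IN ITS OWN NAME (`B14.ThmP245PrintedI`, any `T`-family agreeing with the tower on the trajectory) along the windowed runs — NOTHING ELSE**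
(the `ROpLeaf` is this seat's CLOSED theorem `…B16RLeafRecord13LiveCoPR.rOpLeaf_VOfRecord₁₃CoPR_theta13LiveOfRecord` — zero hypotheses; `hrec : Provisos₁₃CoPR` is only
the datum's key, displayed).
[cite: Balaban1988Convergent, Theorem p.245, Thm 1 p.262, p.244; Balaban1989LargeFieldII, Thm 1 p.355; Balaban1989LargeFieldI, (0.3) p.176, p.177 (i)–(ii)] -/
theorem thm1Printed_datumOfRecord₁₃CoPR_theta13LiveOfRecord_of_thmP245I (hrec : (⟨theta13LiveOfRecord F N, Zr⟩ : Stage13RParams F N).Provisos₁₃CoPR F N) {γ : ℝ} (hγ : 0 < γ)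
    (T : (P : B12.RunParams) → (k : ℕ) → RTOpI (F.P P.K) k (SU N) (avOfRecord F N P.K k))
    (hTT : ∀ (P : B12.RunParams) (k : ℕ), k < P.K →
      (T P k).T (densOfRecord₁₃ F N (theta13LiveOfRecord F N) P k) = tdensOfRecord₁₃ F N (theta13LiveOfRecord F N) P k)
    (hT : ∀ P : B12.RunParams, ((datumOfRecord₁₃CoPR F N (⟨theta13LiveOfRecord F N, Zr⟩ : Stage13RParams F N) hrec).C P).flow.InInterval γ P.K →
      B14.ThmP245PrintedI (T P) (densOfRecord₁₃ F N (theta13LiveOfRecord F N) P) (VOfRecord₁₃CoPR F N (⟨theta13LiveOfRecord F N, Zr⟩ : Stage13RParams F N) P).S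
        (VOfRecord₁₃CoPR F N (⟨theta13LiveOfRecord F N, Zr⟩ : Stage13RParams F N) P).Scorr P.K) :
    B16.Thm1Printed (datumOfRecord₁₃CoPR F N (⟨theta13LiveOfRecord F N, Zr⟩ : Stage13RParams F N) hrec).C :=
  thm1Printed_datumOfRecord₁₃CoPR_of_thmP245I_rAssumedP244 F N (⟨theta13LiveOfRecord F N, Zr⟩ : Stage13RParams F N) hrec hγ T hTT hT
    (fun P _ => (rOpLeaf₁₃CoPR_iff_rAssumedP244 F N (⟨theta13LiveOfRecord F N, Zr⟩ : Stage13RParams F N) P).1 (rOpLeaf_VOfRecord₁₃CoPR_theta13LiveOfRecord F N Zr P))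

/-- **The director's row at the v1.5 SEPARATED-RANGE DATUM `datumOfRecord₁₃SepCoPR F N θ h` (`h : Provisos₁₃SepCoPR`, the K1⁵ key; `= datumOfRecord₁₃CoPR θ h.toCore` by
`rfl`, node00-def-T `datumOfRecord₁₃SepCoPR_eq_coPR`)**: `B16.Thm1Printed` at the live selector from [III]'s Theorem of p. 245 in its own name, the `ROpLeaf` supplied.
[cite: Balaban1988Convergent, Theorem p.245, Thm 1 p.262, p.244; Balaban1989LargeFieldII, Thm 1 p.355; Balaban1989LargeFieldI, (0.3) p.176, p.177 (i)–(ii)] -/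
theorem thm1Printed_datumOfRecord₁₃SepCoPR_of_thmP245I_of_liveSel (h : θ.Provisos₁₃SepCoPR F N) (hθ : θ.Admissible F N) (hκ : 0 ≤ θ.s2.lf.κ)
    (hE₀ : 0 ≤ θ.s2.lf.E₀) (hB₀ : 0 ≤ θ.s2.lf.B₀)
    (hsel : θ.ppSel = ppSelLiveOfRecord F N θ.ν θ.τ9 (EOfRecord₁₃ F N θ.toStage13Params) (wOfRecord₉ F N θ.toStage9Params)) {γ : ℝ} (hγ : 0 < γ)
    (T : (P : B12.RunParams) → (k : ℕ) → RTOpI (F.P P.K) k (SU N) (avOfRecord F N P.K k))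
    (hTT : ∀ (P : B12.RunParams) (k : ℕ), k < P.K → (T P k).T (densOfRecord₁₃ F N θ.toStage13Params P k) = tdensOfRecord₁₃ F N θ.toStage13Params P k)
    (hT : ∀ P : B12.RunParams, ((datumOfRecord₁₃SepCoPR F N θ h).C P).flow.InInterval γ P.K →
      B14.ThmP245PrintedI (T P) (densOfRecord₁₃ F N θ.toStage13Params P) (VOfRecord₁₃CoPR F N θ P).S (VOfRecord₁₃CoPR F N θ P).Scorr P.K) :
    B16.Thm1Printed (datumOfRecord₁₃SepCoPR F N θ h).C :=
  thm1Printed_datumOfRecord₁₃CoPR_of_thmP245I_of_liveSel F N θ h.toCore hθ hκ hE₀ hB₀ hsel hγ T hTT hT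

end Thm1Printed

end Literature.MathematicalPhysics.QuantumFieldTheory.Balaban1983to89.B14NodeKnitRecord13RCoPR

end
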